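import Literature.NumberTheory.Automorphic.DiscreteSummandProjection
import Literature.NumberTheory.Automorphic.AutomorphicSpectrumProofs
import Mathlib.MeasureTheory.Integral.Bochner.ContinuousLinearMap
import HarnessLib

/-!
# The spectral projection onto a discrete summand commutes with Bochner-integrated (convolution-type) operators `∫ a(t) • R(c t) · dρ`

Topic `NumberTheory/Automorphic`; namespaces `Literature.NumberTheory.Automorphic.AdelicGroupData` (integrability of the weighted orbit map) and
`Literature.NumberTheory.Automorphic.DiscreteAutomorphicRep` (commutation).  Theorems only (no definition, no named fact, no `sorry`).

For an automorphic measure `μ` (★ `isStronglyContinuous_rightRegular_holds`: the regular representation is strongly continuous), a measurable parameter space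
`(T, ρ)` with a CONTINUOUS curve∕map `c : T → G(𝔸_K)` and an integrable scalar weight `a : T → ℂ`, the weighted orbit map `t ↦ a t • R(c t) v` is Bochner
integrable (`integrable_smul_rightRegular`: continuous in `t`, norm `|a t|·‖v‖` by unitarity), and the orthogonal projection `pr_P` onto a discrete automorphic
`P` commutes with the operator `v ↦ ∫ a(t) • R(c t) v dρ(t)` (`starProjection_integral_smul_rightRegular`): `pr_P` is a continuous linear map, so it passes under
the Bochner integral (Mathlib `ContinuousLinearMap.integral_comp_comm`), and it commutes with each `R(c t)` (★ `starProjection_rightRegular`, [Bump1997, proof of Thm.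
3.6.1, p. 342]).  This is step h2 of the regularity road (h) for the spectral-projection letter (D) of crux H413 (Hodge-CM cell, `F0/P2/CENSUS-R.v2`): with `T = U(2,1)`,
`ρ` = Haar, `c = ιinf` and `a = α` a test function, `pr_P (T_α [Φ]) = T_α (pr_P [Φ])`.

## References
* [Bump1997] D. Bump, *Automorphic forms and representations* (1997), proof of Thm. 3.6.1, p. 342.
* [BorelJacquet1979] A. Borel, H. Jacquet, Corvallis PSPM 33.1 (1979), §4.6.
-/

noncomputable section

open MeasureTheory
open scoped InnerProductSpace

namespace Literature.NumberTheory.Automorphic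

universe u

namespace AdelicGroupData

variable {K : Type} [Field K] [NumberField K] (𝒢 : AdelicGroupData.{u} K) (μ : Measure 𝒢.automorphicQuotient)
  [𝒢.IsAutomorphicMeasure μ]

/-- **The weighted orbit map `t ↦ a t • R(c t) v` is Bochner integrable** for `c` continuous and `a` integrable: it is a.e.-strongly measurable (strong continuity of
`R`, ★ `isStronglyContinuous_rightRegular_holds`) with norm `|a t|·‖v‖` (`R` is norm preserving, ★ `norm_rightRegular_apply`). [cite: BorelJacquet1979, §4.6] -/
theorem integrable_smul_rightRegular {T : Type*} [TopologicalSpace T] [MeasurableSpace T] [OpensMeasurableSpace T]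
    [SecondCountableTopology T] (ρ : Measure T)
    {c : T → 𝒢.Adelic} (hc : Continuous c) {a : T → ℂ} (ha : Integrable a ρ) (v : 𝒢.L2 μ) :
    Integrable (fun t => a t • 𝒢.rightRegular μ (c t) v) ρ := by
  have hcont : Continuous fun t => 𝒢.rightRegular μ (c t) v :=
    (𝒢.isStronglyContinuous_rightRegular_holds μ v).comp hc
  refine ⟨ha.aestronglyMeasurable.smul hcont.aestronglyMeasurable, ?_⟩
  have hnorm : ∀ t, ‖a t • 𝒢.rightRegular μ (c t) v‖ = ‖a t‖ * ‖v‖ := fun t => by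
    rw [norm_smul, 𝒢.norm_rightRegular_apply μ (c t) v]
  have : HasFiniteIntegral (fun t => ‖a t‖ * ‖v‖) ρ := (ha.norm.mul_const ‖v‖).hasFiniteIntegral
  exact this.mono' (Filter.Eventually.of_forall fun t => (hnorm t).le)

end AdelicGroupData

namespace DiscreteAutomorphicRep

variable {K : Type} [Field K] [NumberField K] {𝒢 : AdelicGroupData.{u} K} {μ : Measure 𝒢.automorphicQuotient}
  [𝒢.IsAutomorphicMeasure μ]

/-- **`pr_P` commutes with the integrated operator `v ↦ ∫ a(t) • R(c t) v dρ(t)`**: `pr_P (∫ a t • R(c t) v dρ) = ∫ a t • R(c t) (pr_P v) dρ` — `pr_P` passes under the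
Bochner integral (continuous linear) and commutes with each `R(c t)` (★ `starProjection_rightRegular`). [cite: Bump1997, proof of Thm. 3.6.1 (p. 342)] [cite: BorelJacquet1979, §4.6] -/
theorem starProjection_integral_smul_rightRegular (P : DiscreteAutomorphicRep 𝒢 μ) {T : Type*} [MeasurableSpace T] (ρ : Measure T)
    {c : T → 𝒢.Adelic} {a : T → ℂ} (v : 𝒢.L2 μ) (hint : Integrable (fun t => a t • 𝒢.rightRegular μ (c t) v) ρ) :
    P.space.toSubmodule.starProjection (∫ t, a t • 𝒢.rightRegular μ (c t) v ∂ρ) =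
      ∫ t, a t • 𝒢.rightRegular μ (c t) (P.space.toSubmodule.starProjection v) ∂ρ := by
  rw [← ContinuousLinearMap.integral_comp_comm _ hint]
  refine integral_congr_ae (Filter.Eventually.of_forall fun t => ?_)
  simp only [map_smul, starProjection_rightRegular]

/-- The same for continuous `c` and integrable `a` (integrability supplied by `integrable_smul_rightRegular`). [cite: Bump1997, proof of Thm. 3.6.1 (p. 342)] -/
theorem starProjection_integral_smul_rightRegular_of_continuous (P : DiscreteAutomorphicRep 𝒢 μ) {T : Type*} [TopologicalSpace T] [MeasurableSpace T]
    [OpensMeasurableSpace T] [SecondCountableTopology T] (ρ : Measure T) {c : T → 𝒢.Adelic} (hc : Continuous c) {a : T → ℂ} (ha : Integrable a ρ) (v : 𝒢.L2 μ) :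
    P.space.toSubmodule.starProjection (∫ t, a t • 𝒢.rightRegular μ (c t) v ∂ρ) =
      ∫ t, a t • 𝒢.rightRegular μ (c t) (P.space.toSubmodule.starProjection v) ∂ρ :=
  P.starProjection_integral_smul_rightRegular ρ v (AdelicGroupData.integrable_smul_rightRegular 𝒢 μ ρ hc ha v)

/-- **Fixed vectors of an integrated operator stay fixed after projection**: if `∫ a t • R(c t) v dρ = v` then `∫ a t • R(c t) (pr_P v) dρ = pr_P v` — the form in which the
reproduction identity `T_α [Φ] = [Φ]` of a holomorphic form transfers to `w = pr_P [Φ]`. [cite: Bump1997, proof of Thm. 3.6.1 (p. 342)] -/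
theorem integral_smul_rightRegular_starProjection_eq_self (P : DiscreteAutomorphicRep 𝒢 μ) {T : Type*} [MeasurableSpace T] (ρ : Measure T)
    {c : T → 𝒢.Adelic} {a : T → ℂ} {v : 𝒢.L2 μ} (hint : Integrable (fun t => a t • 𝒢.rightRegular μ (c t) v) ρ)
    (hfix : ∫ t, a t • 𝒢.rightRegular μ (c t) v ∂ρ = v) :
    ∫ t, a t • 𝒢.rightRegular μ (c t) (P.space.toSubmodule.starProjection v) ∂ρ = P.space.toSubmodule.starProjection v := by
  rw [← P.starProjection_integral_smul_rightRegular ρ v hint, hfix]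

end DiscreteAutomorphicRep

end Literature.NumberTheory.Automorphic

end
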